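import Literature.NumberTheory.Automorphic.SatakeIsomorphismModP
import Literature.NumberTheory.Automorphic.GLnSphericalHeckeAlgebraTriangularProducts
import Mathlib.Algebra.Order.Rearrangement
import Mathlib.Data.Fin.Tuple.Sort
import HarnessLib

/-!
# The integral Satake isomorphism for `GL_n`: the image of the counting transform
# `𝒮_1 = CT^{cl} : ℋ_R(GL_n(F), GL_n(𝒪)) → R[ℤⁿ]` over EVERY commutative ring `R` (X. Zhu, §1.4 Prop. 9 with §1.3 Lemma 8)

Topic `NumberTheory/Automorphic`; namespace `Literature.NumberTheory.Automorphic` (lane `lit-hodgefound`, Track 2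
foundations; seat `lit-hodgefound-p11`, generation 43, row g43-#1).  THEOREMS ONLY: no definition, no named fact, no
instance, no notation.  Setting: a field `F` with a `ValuativeRel` whose valuation ring `𝒪 = 𝒪[F]` is a DVR with finite
residue field `𝓀` of cardinality `q` (any characteristic, no completeness), a uniformizer `ϖ`, `K = GL_n(𝒪) = glInt n F`,
the Hecke algebra `ℋ_R = heckeAlgebra R (GL (Fin n) F) (glInt n F)` over an ARBITRARY commutative ring `R`, and the COUNTING
transform `𝒮_1 = (isIwasawaExponent_gl hϖ).satakeTransform 1 : ℋ_R →ₐ[R] R[ℤⁿ]` of `SatakeTransformIwasawa` /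
`SatakeTransformGLIwasawaDatum` — the coefficient of `x^μ` in `𝒮_1(T_{KgK})` is `N_μ(g) = #{γ ∈ KgK/K : γ = u ϖ^μ K}`
`= ∑_{u ∈ U(F)/U(𝒪)} 𝟙_{KgK}(ϖ^μ u)`, i.e. `𝒮_1` is Zhu's `CT^{cl}`, Herzig's `𝒮` (trivial weight), Treumann–Venkatesh's `𝒮^*`.
It is injective over every `R` (g42-#1 `satakeTransform_gl_injective_of_commRing`).  This file computes ITS IMAGE over every
`R`, unifying the two cases already in the tree: `q ∈ Rˣ` (g42-#6 `SatakeIsomorphismModP`: after the twist `x^μ ↦ q^{-⟨ν, μ⟩} x^μ`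
the image is `R[ℤⁿ]^{S_n}`) and `q = 0` in `R` (g42-#12 `SatakeIsomorphismCharPGL`, Herzig: Laurent polynomials with
antidominant exponents).

## The print

[ZhuIntegralSatake2020] §1.3 (twisted `W`-action, arXiv p. 6): «`w ∙_λ e^{λ̂} = q^{⟨λ, wλ̂ - λ̂⟩} e^{wλ̂}`, `w ∈ W_0`»; Lemma 8:
«The image of the map `ℤ[V_{T̂}|_{d=λ(q)}]^{c_σ(N̂_0)} → ℤ[X^•(T̂)]` is the subring of `ℤ[X^•(T̂)^σ]` with a `ℤ`-basis given by
elements of the form `∑_{λ̂' ∈ W_0 λ̂} q^{⟨λ, λ̂' - λ̂⟩} e^{λ̂'}`, `λ̂ ∈ X^•(T̂)^{σ,-} := X^•(T̂)^σ ∩ X^•(T̂)^-`»; §1.4 (p. 6):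
«`H_G = C_c(K\G(F)/K, ℤ)` […] we define the classical Satake transform
`CT^{cl} : H_G → ℤ[X^•(T̂)^σ]`, `f ↦ ∑_{λ̂} (∑_{u ∈ U(F)/U(𝒪)} f(λ̂(ϖ) u)) e^{λ̂}`»; **Proposition 9**: «There exists a unique
isomorphism `Sat^{cl} : ℤ[V_{Ĝ,ρ_ad} ⋊ ⟨σ⟩|_{d̃_{ρ_ad} = (q,σ)}]^{Ĝ} ≅ H_G` […] making the diagram [with `CT^{cl}` and the
embedding of Lemma 8, `λ = ρ_ad`] commutative.  In particular, `H_G` is finitely generated»; proof (p. 7): «it is enough to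
show that the Satake transform induces an isomorphism `CT^{cl} : H_G ≅ ℤ[X^•(T̂)^σ] ∩ ℚ[X^•(T̂)^σ]^{W_0 ∙_{ρ_ad}}` […] this follows
from the usual Satake isomorphism by noticing that `CT^{cl}` differs from the usual Satake transform by a square root of the
modular character».  Here `G = GL_n` split (`σ = 1`), `W_0 = S_n` acting by coordinate permutations `μ ↦ μ ∘ σ`,
`X^•(T̂) = ℤⁿ`, the antidominant cone `X^•(T̂)^-` for the upper-triangular Borel = the MONOTONE `μ` (`μ_1 ≤ ⋯ ≤ μ_n`), and
`⟨ρ_ad, μ' - μ⟩ = ⟨ν, μ'⟩ - ⟨ν, μ⟩` for `μ' ∈ S_n μ` with `ν = (n-1, …, 1, 0)` (`satakeTwistExp`; `|μ'| = |μ|`), which is `≥ 0` for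
`μ` antidominant (rearrangement inequality).  Coefficients: Zhu's `ℤ` is replaced by an arbitrary commutative `R` (the
statement over `R` contains the one over `ℤ` and is proved uniformly; `ℋ_R = R ⊗ ℋ_ℤ`, g42-#7).
[TreumannVenkatesh2016] §7.2 (the transform `𝒮^*`, the `q`-twisted `W`-action); [Herzig2010] Thm. 1.2 (`q = 0`);
[BruhatTits1972] (4.4.4) (leading terms); [Macdonald1995] Ch. V (2.6) (unitriangularity).

## What is formalised (theorems only)

* §1 `satakeTwistExp_le_satakeTwistExp_comp_perm` (**rearrangement**: `⟨ν, μ⟩ ≤ ⟨ν, μ∘σ⟩` for `μ` monotone),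
  `satakeTwistExp_comp_perm_eq_iff` (equality iff `μ ∘ σ = μ`), antidominant representatives `μ ∘ sort μ`
  (`eq_of_monotone_of_comp_perm_eq`, `mem_image_comp_perm_iff_eq_comp_sort`, …).
* §2 **`card_filter_iwasawaExp_eq_comp_perm`**: `N_{μ∘σ}(g) = q^{⟨ν, μ∘σ⟩ - ⟨ν, μ⟩} N_μ(g)` in `ℕ` (`μ` monotone) — from the
  `S_n`-invariance of `𝒮_ℚ` (g42-#6).
* §3 **`coeff_satakeTransform_one_comp_perm`**: `𝒮_1(T)_{μ∘σ} = q^{⟨ν, μ∘σ⟩ - ⟨ν, μ⟩} 𝒮_1(T)_μ` for every `T ∈ ℋ_R`, every `R`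
  (the image is `W ∙`-invariant); `coeff_satakeTransform_one_comp_sort_ne_zero` (for `q = 0` in `R` this is Herzig's
  antidominant support, the tree's `monotone_of_coeff_satakeTransform_one_ne_zero`).
* §4 the orbit sums `m_λ = ∑_{μ ∈ S_n λ} q^{⟨ν, μ⟩ - ⟨ν, λ⟩} x^μ` (written out, no definition): `coeff_twistedOrbitSum`, `…_self` (`= 1` at
  `x^λ`), `…_eq_zero`, `…_comp_perm`; **`eq_sum_coeff_smul_twistedOrbitSum`** (a `W ∙`-invariant `f` is `∑_λ f_λ m_λ` over the
  antidominant representatives of its support); **`linearIndependent_twistedOrbitSum`** (Lemma 8, independence).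
* §5 **`twistedOrbitSum_mem_range_satakeTransform_one`**: every `m_λ` is a transform — unitriangular induction on the potential
  defect `∑_{s ≤ n} ∑_{i<s} (λ_n - λ_i)`, using the leading coefficient `1` of `𝒮_1(c_λ)` at `x^λ` (Bruhat–Tits (4.4.4) (ii),
  g42-#1/#2) and the dominance/degree control of its support (g42-#2/#3).
* §6 **`mem_range_satakeTransform_one_iff`** (PROP. 9 FOR `GL_n` OVER ANY `R`: `f ∈ 𝒮_1(ℋ_R)` iff
  `f_{μ∘σ} = q^{⟨ν, μ∘σ⟩ - ⟨ν, μ⟩} f_μ` for all monotone `μ` and all `σ`), **`range_satakeTransform_one_toSubmodule_eq_span`**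
  (`𝒮_1(ℋ_R) = span_R {m_λ}`), **`exists_basis_range_satakeTransform_one`** (LEMMA 8: the `m_λ`, `λ` antidominant, form an
  `R`-basis of the image), `exists_basis_heckeAlgebra_satakeTransform_eq_twistedOrbitSum` (`ℋ_R` is free on `𝒮_1⁻¹(m_λ)`).

## References
* [ZhuIntegralSatake2020] X. Zhu, *A note on integral Satake isomorphisms*, arXiv:2005.13056 (2020; in: Arithmetic
  Geometry, TIFR 2024), §1.3 Lemma 8, §1.4 Prop. 9 and its proof (arXiv pp. 6–7).
* [TreumannVenkatesh2016] D. Treumann, A. Venkatesh, *Functoriality, Smith theory, and the Brauer homomorphism*,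
  Ann. of Math. 183 (2016), §7.2.
* [Herzig2010] F. Herzig, *A Satake isomorphism in characteristic p*, Compositio Math. 147 (2011), Thm. 1.2.
* [BruhatTits1972] F. Bruhat, J. Tits, *Groupes réductifs sur un corps local I*, Publ. Math. IHÉS 41 (1972), Prop. (4.4.4).
* [Macdonald1995] I. G. Macdonald, *Symmetric Functions and Hall Polynomials*, 2nd ed. (1995), Ch. V (2.6).
-/

noncomputable section

open scoped MatrixGroups Pointwise
open ValuativeRel Matrix Finset MonoidAlgebra Representation MulAction

namespace Literature.NumberTheory.Automorphic

/-! ## §1 The twist exponent `⟨ν, ·⟩` on `S_n`-orbits: rearrangement, antidominant representatives -/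

section Twist

variable {n : ℕ}

/-- The weight vector `ν = (n-1, n-2, …, 0)` of `satakeTwistExp` is antitone. [cite: ZhuIntegralSatake2020, §1.3 (twisted W-action)] -/
theorem antitone_satakeTwistWeight : Antitone (fun i : Fin n => ((n : ℤ) - 1 - (i : ℕ))) := by
  intro i j hij
  have h := Fin.le_def.1 hij
  simp only
  omega

/-- **Rearrangement**: for `μ` monotone (antidominant) and any coordinate permutation `σ`,
`⟨ν, μ⟩ ≤ ⟨ν, μ ∘ σ⟩` — the antidominant representative minimises the twist exponent on its `S_n`-orbit, so that
`q^{⟨ν, μ∘σ⟩ - ⟨ν, μ⟩} = q^{⟨ρ, μ∘σ - μ⟩}` is an honest power of `q`. [cite: ZhuIntegralSatake2020, §1.3 Lemma 8] -/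
theorem satakeTwistExp_le_satakeTwistExp_comp_perm {μ : Fin n → ℤ} (hμ : Monotone μ) (σ : Equiv.Perm (Fin n)) :
    satakeTwistExp μ ≤ satakeTwistExp (μ ∘ σ) := by
  unfold satakeTwistExp
  simp only [Function.comp_apply]
  exact (antitone_satakeTwistWeight.antivary hμ).sum_mul_le_sum_mul_comp_perm

/-- The exponent `⟨ν, μ∘σ⟩ - ⟨ν, μ⟩` as a natural number. [cite: ZhuIntegralSatake2020, §1.3 Lemma 8] -/
theorem toNat_satakeTwistExp_comp_perm_sub {μ : Fin n → ℤ} (hμ : Monotone μ) (σ : Equiv.Perm (Fin n)) :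
    ((satakeTwistExp (μ ∘ σ) - satakeTwistExp μ).toNat : ℤ) = satakeTwistExp (μ ∘ σ) - satakeTwistExp μ :=
  Int.toNat_of_nonneg (sub_nonneg.2 (satakeTwistExp_le_satakeTwistExp_comp_perm hμ σ))

/-- **Equality case**: for `μ` monotone, `⟨ν, μ ∘ σ⟩ = ⟨ν, μ⟩` iff `μ ∘ σ = μ` (the weight `ν` is STRICTLY antitone).
[cite: ZhuIntegralSatake2020, §1.3 Lemma 8] -/
theorem satakeTwistExp_comp_perm_eq_iff {μ : Fin n → ℤ} (hμ : Monotone μ) (σ : Equiv.Perm (Fin n)) :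
    satakeTwistExp (μ ∘ σ) = satakeTwistExp μ ↔ μ ∘ σ = μ := by
  refine ⟨fun h => ?_, fun h => by rw [h]⟩
  have hav : Antivary (fun i : Fin n => ((n : ℤ) - 1 - (i : ℕ))) (μ ∘ σ) := by
    refine ((antitone_satakeTwistWeight.antivary hμ).sum_mul_eq_sum_mul_comp_perm_iff).1 ?_
    unfold satakeTwistExp at h
    simpa only [Function.comp_apply] using h
  have hmono : Monotone (μ ∘ σ) := by
    intro i j hij
    rcases hij.lt_or_eq with hlt | rfl
    · by_contra hle
      have h1 := hav (not_le.1 hle)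
      have h2 := Fin.lt_def.1 hlt
      simp only at h1
      omega
    · exact le_rfl
  have := Tuple.unique_monotone (f := μ) (σ := σ) (τ := Equiv.refl _) hmono
    (by simpa only [Equiv.coe_refl, Function.comp_id] using hμ)
  simpa only [Equiv.coe_refl, Function.comp_id] using this

/-- Two monotone vectors in the same `S_n`-orbit are equal (uniqueness of the antidominant representative).
[cite: ZhuIntegralSatake2020, §1.3 Lemma 8] -/
theorem eq_of_monotone_of_comp_perm_eq {ν ν' : Fin n → ℤ} (hν : Monotone ν) (hν' : Monotone ν')
    {σ : Equiv.Perm (Fin n)} (h : ν ∘ σ = ν') : ν = ν' := by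
  have h1 : Monotone (ν ∘ σ) := by rw [h]; exact hν'
  have h2 := Tuple.unique_monotone (f := ν) (σ := σ) (τ := Equiv.refl _) h1
    (by simpa only [Equiv.coe_refl, Function.comp_id] using hν)
  rw [h, Equiv.coe_refl, Function.comp_id] at h2
  exact h2.symm

/-- The antidominant representative `μ ∘ sort μ` of the orbit of `μ` is monotone. [cite: ZhuIntegralSatake2020, §1.3 Lemma 8] -/
theorem monotone_comp_sort (μ : Fin n → ℤ) : Monotone (μ ∘ Tuple.sort μ) :=
  Tuple.monotone_sort μ

/-- `μ = (μ ∘ sort μ) ∘ (sort μ)⁻¹`: every exponent is a coordinate permutation of its antidominant representative.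
[cite: ZhuIntegralSatake2020, §1.3 Lemma 8] -/
theorem comp_sort_comp_symm (μ : Fin n → ℤ) : (μ ∘ Tuple.sort μ) ∘ (Tuple.sort μ).symm = μ := by
  funext i
  simp only [Function.comp_apply, Equiv.apply_symm_apply]

/-- Membership in the orbit finset `{ν ∘ σ : σ ∈ S_n}`. [cite: ZhuIntegralSatake2020, §1.3 Lemma 8] -/
theorem mem_image_comp_perm_iff {ν μ : Fin n → ℤ} :
    μ ∈ (Finset.univ : Finset (Equiv.Perm (Fin n))).image (fun σ : Equiv.Perm (Fin n) => ν ∘ ⇑σ) ↔ ∃ σ : Equiv.Perm (Fin n), ν ∘ σ = μ := by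
  simp only [Finset.mem_image, Finset.mem_univ, true_and]

/-- `ν` lies in its own orbit finset. [cite: ZhuIntegralSatake2020, §1.3 Lemma 8] -/
theorem self_mem_image_comp_perm (ν : Fin n → ℤ) :
    ν ∈ (Finset.univ : Finset (Equiv.Perm (Fin n))).image (fun σ : Equiv.Perm (Fin n) => ν ∘ ⇑σ) :=
  mem_image_comp_perm_iff.2 ⟨Equiv.refl _, by rw [Equiv.coe_refl, Function.comp_id]⟩

/-- For MONOTONE `ν`, `μ` lies in the orbit finset of `ν` iff `ν` is the antidominant representative `μ ∘ sort μ` of `μ`.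
[cite: ZhuIntegralSatake2020, §1.3 Lemma 8] -/
theorem mem_image_comp_perm_iff_eq_comp_sort {ν μ : Fin n → ℤ} (hν : Monotone ν) :
    μ ∈ (Finset.univ : Finset (Equiv.Perm (Fin n))).image (fun σ : Equiv.Perm (Fin n) => ν ∘ ⇑σ) ↔ ν = μ ∘ Tuple.sort μ := by
  rw [mem_image_comp_perm_iff]
  constructor
  · rintro ⟨σ, rfl⟩
    exact eq_of_monotone_of_comp_perm_eq hν (monotone_comp_sort _) (σ := σ * Tuple.sort (ν ∘ σ))
      (by rw [Equiv.Perm.coe_mul, ← Function.comp_assoc])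
  · intro h
    exact ⟨(Tuple.sort μ).symm, by rw [h, comp_sort_comp_symm]⟩

end Twist

/-! ## §2 The coefficients of `𝒮_1(T_g)` along an `S_n`-orbit: `N_{μ∘σ}(g) = q^{⟨ν, μ∘σ⟩ - ⟨ν, μ⟩} N_μ(g)` (`μ` monotone) -/

section Counts

variable {F : Type*} [Field F] [ValuativeRel F] {n : ℕ} [IsDiscreteValuationRing 𝒪[F]] [Finite 𝓀[F]] {ϖ : F}
  [IsHeckeTriple (⊤ : Submonoid (GL (Fin n) F)) (glInt n F) (glInt n F)]

/-- `q = #𝓀 ≠ 0` in `ℚ`, so the Satake transform with coefficients in `ℚ` (`q ∈ ℚˣ`) is available.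
[cite: TreumannVenkatesh2016, §7.2] -/
theorem isUnit_natCard_residueField_rat : IsUnit ((Nat.card 𝓀[F] : ℕ) : ℚ) :=
  isUnit_iff_ne_zero.2 (by exact_mod_cast (Nat.card_pos (α := 𝓀[F])).ne')

/-- **THE ORBIT RELATION FOR THE COSET COUNTS** (`μ` monotone, `σ ∈ S_n`, any `g ∈ GL_n(F)`):
`#{α ∈ KgK/K : e(α) = μ ∘ σ} = q^{⟨ν, μ∘σ⟩ - ⟨ν, μ⟩} · #{α ∈ KgK/K : e(α) = μ}` — an identity of NATURAL NUMBERS, read off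
from the `S_n`-invariance of the Satake transform with coefficients in `ℚ` (`𝒮_ℚ(T_g) ∈ ℚ[ℤⁿ]^{S_n}`, g42-#6, whose coefficient
at `x^e` is `q^{-⟨ν, e⟩} #{α : e(α) = e}`); the exponent is `≥ 0` by rearrangement.  This is the integrality behind Zhu's
twisted action `w ∙ e^μ = q^{⟨ρ, wμ - μ⟩} e^{wμ}`. [cite: ZhuIntegralSatake2020, §1.3 (twisted W-action), §1.4 Prop. 9]
[cite: TreumannVenkatesh2016, §7.2 Theorem (i)] -/
theorem card_filter_iwasawaExp_eq_comp_perm (hϖ : IsUniformizingElement ϖ) (g : GL (Fin n) F) {μ : Fin n → ℤ}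
    (hμ : Monotone μ) (σ : Equiv.Perm (Fin n))
    [DecidablePred fun α : GL (Fin n) F ⧸ glInt n F => iwasawaExp hϖ α.out = μ ∘ σ]
    [DecidablePred fun α : GL (Fin n) F ⧸ glInt n F => iwasawaExp hϖ α.out = μ] :
    ((finite_orbit_quotient (glInt n F) g).toFinset.filter fun α => iwasawaExp hϖ α.out = μ ∘ σ).card =
      Nat.card 𝓀[F] ^ (satakeTwistExp (μ ∘ σ) - satakeTwistExp μ).toNat *
        ((finite_orbit_quotient (glInt n F) g).toFinset.filter fun α => iwasawaExp hϖ α.out = μ).card := by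
  have hq : IsUnit ((Nat.card 𝓀[F] : ℕ) : ℚ) := isUnit_natCard_residueField_rat
  have hq0 : ((Nat.card 𝓀[F] : ℕ) : ℚ) ≠ 0 := hq.ne_zero
  obtain ⟨w, hw⟩ := exists_monoidHom_apply_ofAdd_eq_satakeWeightUnit (n := n) hq.unit
  have hinv := satakeTransformModP_mem_weylInvariants hϖ hq (heckeAlgebra.doubleCosetOperator (k := ℚ) (glInt n F) g)
  rw [mem_weylInvariants_glWeylGroup_iff] at hinv
  have hcoeff := (domCongr_eq_self_iff_coeff _ _).1 (hinv σ) μ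
  rw [SymmLaurent.funCongrLeft_toAddEquiv_apply,
    satakeTransformModP_eq_isIwasawaExponent_satakeTransform hϖ hq hw,
    (isIwasawaExponent_gl hϖ).coeff_satakeTransform_doubleCosetOperator w g (μ ∘ σ),
    (isIwasawaExponent_gl hϖ).coeff_satakeTransform_doubleCosetOperator w g μ, hw, hw,
    coe_satakeWeightUnit, coe_satakeWeightUnit, hq.unit_spec] at hcoeff
  -- `hcoeff : Nσ * q ^ (-⟨ν, μ∘σ⟩) = N * q ^ (-⟨ν, μ⟩)` in `ℚ`
  have hk := toNat_satakeTwistExp_comp_perm_sub hμ σ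
  have key : ((((finite_orbit_quotient (glInt n F) g).toFinset.filter
      fun α => iwasawaExp hϖ α.out = μ ∘ σ).card : ℕ) : ℚ) =
      ((Nat.card 𝓀[F] : ℕ) : ℚ) ^ (satakeTwistExp (μ ∘ σ) - satakeTwistExp μ).toNat *
        ((((finite_orbit_quotient (glInt n F) g).toFinset.filter fun α => iwasawaExp hϖ α.out = μ).card : ℕ) : ℚ) := by
    calc ((((finite_orbit_quotient (glInt n F) g).toFinset.filter
            fun α => iwasawaExp hϖ α.out = μ ∘ σ).card : ℕ) : ℚ)
        = ((((finite_orbit_quotient (glInt n F) g).toFinset.filter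
            fun α => iwasawaExp hϖ α.out = μ ∘ σ).card : ℕ) : ℚ) *
            ((Nat.card 𝓀[F] : ℕ) : ℚ) ^ (-satakeTwistExp (μ ∘ σ)) *
              ((Nat.card 𝓀[F] : ℕ) : ℚ) ^ satakeTwistExp (μ ∘ σ) := by
          rw [mul_assoc, ← zpow_add₀ hq0, neg_add_cancel, zpow_zero, mul_one]
      _ = ((((finite_orbit_quotient (glInt n F) g).toFinset.filter fun α => iwasawaExp hϖ α.out = μ).card : ℕ) : ℚ) *
            ((Nat.card 𝓀[F] : ℕ) : ℚ) ^ (-satakeTwistExp μ) * ((Nat.card 𝓀[F] : ℕ) : ℚ) ^ satakeTwistExp (μ ∘ σ) := by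
          rw [hcoeff]
      _ = ((Nat.card 𝓀[F] : ℕ) : ℚ) ^ (satakeTwistExp (μ ∘ σ) - satakeTwistExp μ).toNat *
            ((((finite_orbit_quotient (glInt n F) g).toFinset.filter fun α => iwasawaExp hϖ α.out = μ).card : ℕ) : ℚ) := by
          rw [mul_assoc, ← zpow_add₀ hq0, ← zpow_natCast, hk, mul_comm, neg_add_eq_sub]
  exact_mod_cast key

end Counts

/-! ## §3 The orbit relation for `𝒮_1(T)`, every `T ∈ ℋ_R`, every commutative ring `R` -/

section Image

variable {F : Type*} [Field F] [ValuativeRel F] {n : ℕ} [IsDiscreteValuationRing 𝒪[F]] [Finite 𝓀[F]] {ϖ : F}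
  [IsHeckeTriple (⊤ : Submonoid (GL (Fin n) F)) (glInt n F) (glInt n F)] {R : Type*} [CommRing R]

/-- **THE COEFFICIENTS OF A COUNTING TRANSFORM ALONG AN `S_n`-ORBIT** (any commutative ring `R`, any `T ∈ ℋ_R`):
for `μ` monotone (antidominant) and `σ ∈ S_n`, `𝒮_1(T)_{μ∘σ} = q^{⟨ν, μ∘σ⟩ - ⟨ν, μ⟩} · 𝒮_1(T)_μ` — the image of
`CT^{cl} = 𝒮_1` is invariant under Zhu's twisted action `w ∙ e^μ = q^{⟨ρ, wμ - μ⟩} e^{wμ}`.  From the coset-count identity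
(`card_filter_iwasawaExp_eq_comp_perm`) on the double-coset operators, which span `ℋ_R`.
[cite: ZhuIntegralSatake2020, §1.4 Prop. 9, proof] [cite: TreumannVenkatesh2016, §7.2] -/
theorem coeff_satakeTransform_one_comp_perm (hϖ : IsUniformizingElement ϖ)
    (T : heckeAlgebra R (GL (Fin n) F) (glInt n F)) {μ : Fin n → ℤ} (hμ : Monotone μ) (σ : Equiv.Perm (Fin n)) :
    ((isIwasawaExponent_gl hϖ).satakeTransform (1 : Multiplicative (Fin n → ℤ) →* R) T).coeff (μ ∘ σ) =
      ((Nat.card 𝓀[F] : ℕ) : R) ^ (satakeTwistExp (μ ∘ σ) - satakeTwistExp μ).toNat *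
        ((isIwasawaExponent_gl hϖ).satakeTransform (1 : Multiplicative (Fin n → ℤ) →* R) T).coeff μ := by
  classical
  refine Submodule.span_induction (p := fun T _ =>
      ((isIwasawaExponent_gl hϖ).satakeTransform (1 : Multiplicative (Fin n → ℤ) →* R) T).coeff (μ ∘ σ) =
        ((Nat.card 𝓀[F] : ℕ) : R) ^ (satakeTwistExp (μ ∘ σ) - satakeTwistExp μ).toNat *
          ((isIwasawaExponent_gl hϖ).satakeTransform (1 : Multiplicative (Fin n → ℤ) →* R) T).coeff μ)
    ?_ ?_ ?_ ?_ (heckeAlgebra.mem_span_range_doubleCosetOperator (k := R) (glInt n F) T)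
  · rintro _ ⟨g, rfl⟩
    rw [(isIwasawaExponent_gl hϖ).coeff_satakeTransform_doubleCosetOperator 1 g (μ ∘ σ),
      (isIwasawaExponent_gl hϖ).coeff_satakeTransform_doubleCosetOperator 1 g μ, MonoidHom.one_apply,
      MonoidHom.one_apply, mul_one, mul_one, card_filter_iwasawaExp_eq_comp_perm hϖ g hμ σ, Nat.cast_mul, Nat.cast_pow]
  · simp only [map_zero, AddMonoidAlgebra.coeff_zero, Finsupp.coe_zero, Pi.zero_apply, mul_zero]
  · intro x y _ _ hx hy
    rw [map_add, AddMonoidAlgebra.coeff_add, Finsupp.add_apply, Finsupp.add_apply, hx, hy, mul_add]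
  · intro c x _ hx
    rw [map_smul, AddMonoidAlgebra.coeff_smul, Finsupp.smul_apply, Finsupp.smul_apply, hx, smul_eq_mul, smul_eq_mul,
      mul_left_comm]

/-- Off the twisted orbit relation nothing survives: if `μ` is monotone and `𝒮_1(T)_μ = 0`, then `𝒮_1(T)_{μ∘σ} = 0` for every
`σ` — the support of a counting transform meets every `S_n`-orbit it touches in the antidominant representative.
[cite: ZhuIntegralSatake2020, §1.3 Lemma 8] -/
theorem coeff_satakeTransform_one_comp_perm_eq_zero (hϖ : IsUniformizingElement ϖ)
    (T : heckeAlgebra R (GL (Fin n) F) (glInt n F)) {μ : Fin n → ℤ} (hμ : Monotone μ) (σ : Equiv.Perm (Fin n))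
    (h0 : ((isIwasawaExponent_gl hϖ).satakeTransform (1 : Multiplicative (Fin n → ℤ) →* R) T).coeff μ = 0) :
    ((isIwasawaExponent_gl hϖ).satakeTransform (1 : Multiplicative (Fin n → ℤ) →* R) T).coeff (μ ∘ σ) = 0 := by
  rw [coeff_satakeTransform_one_comp_perm hϖ T hμ σ, h0, mul_zero]

/-- **Antidominant representatives carry the support**: if `x^μ` occurs in `𝒮_1(T)`, so does `x^{μ ∘ sort μ}`.
[cite: ZhuIntegralSatake2020, §1.3 Lemma 8] -/
theorem coeff_satakeTransform_one_comp_sort_ne_zero (hϖ : IsUniformizingElement ϖ)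
    (T : heckeAlgebra R (GL (Fin n) F) (glInt n F)) {μ : Fin n → ℤ}
    (hμ : ((isIwasawaExponent_gl hϖ).satakeTransform (1 : Multiplicative (Fin n → ℤ) →* R) T).coeff μ ≠ 0) :
    ((isIwasawaExponent_gl hϖ).satakeTransform (1 : Multiplicative (Fin n → ℤ) →* R) T).coeff (μ ∘ Tuple.sort μ) ≠ 0 := by
  intro h0
  have h := coeff_satakeTransform_one_comp_perm_eq_zero hϖ T (monotone_comp_sort μ) (Tuple.sort μ).symm h0
  rw [comp_sort_comp_symm] at h
  exact hμ h

end Image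

/-! ## §4 The orbit sums `m_λ = ∑_{μ ∈ S_n λ} q^{⟨ν, μ⟩ - ⟨ν, λ⟩} x^μ` and the expansion of a twisted-invariant element -/

section OrbitSum

variable {F : Type*} [Field F] [ValuativeRel F] {n : ℕ} {R : Type*} [CommRing R]

/-- **Coefficients of the orbit sum** `m_λ = ∑_{μ ∈ S_n λ} q^{⟨ν, μ⟩ - ⟨ν, λ⟩} x^μ`: `q^{⟨ν, μ⟩ - ⟨ν, λ⟩}` on the orbit, `0` off it.
[cite: ZhuIntegralSatake2020, §1.3 Lemma 8] -/
theorem coeff_twistedOrbitSum (ν μ : Fin n → ℤ) :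
    (∑ μ' ∈ (Finset.univ : Finset (Equiv.Perm (Fin n))).image (fun σ : Equiv.Perm (Fin n) => ν ∘ ⇑σ),
        ((Nat.card 𝓀[F] : ℕ) : R) ^ (satakeTwistExp μ' - satakeTwistExp ν).toNat •
          AddMonoidAlgebra.single μ' (1 : R)).coeff μ =
      if μ ∈ (Finset.univ : Finset (Equiv.Perm (Fin n))).image (fun σ : Equiv.Perm (Fin n) => ν ∘ ⇑σ) then
        ((Nat.card 𝓀[F] : ℕ) : R) ^ (satakeTwistExp μ - satakeTwistExp ν).toNat else 0 := by
  classical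
  rw [AddMonoidAlgebra.coeff_sum, Finsupp.finsetSum_apply]
  simp only [AddMonoidAlgebra.coeff_smul, Finsupp.smul_apply, AddMonoidAlgebra.coeff_single, Finsupp.single_apply,
    smul_eq_mul, mul_ite, mul_one, mul_zero]
  rw [Finset.sum_ite_eq']

/-- The orbit sum `m_λ` has coefficient `1` at `x^λ`. [cite: ZhuIntegralSatake2020, §1.3 Lemma 8] -/
theorem coeff_twistedOrbitSum_self (ν : Fin n → ℤ) :
    (∑ μ' ∈ (Finset.univ : Finset (Equiv.Perm (Fin n))).image (fun σ : Equiv.Perm (Fin n) => ν ∘ ⇑σ),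
        ((Nat.card 𝓀[F] : ℕ) : R) ^ (satakeTwistExp μ' - satakeTwistExp ν).toNat •
          AddMonoidAlgebra.single μ' (1 : R)).coeff ν = 1 := by
  rw [coeff_twistedOrbitSum, if_pos (self_mem_image_comp_perm ν), sub_self, Int.toNat_zero, pow_zero]

/-- For MONOTONE `ν ≠` the antidominant representative of `μ`, the orbit sum `m_ν` has no `x^μ` term.
[cite: ZhuIntegralSatake2020, §1.3 Lemma 8] -/
theorem coeff_twistedOrbitSum_eq_zero {ν μ : Fin n → ℤ} (hν : Monotone ν) (h : ν ≠ μ ∘ Tuple.sort μ) :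
    (∑ μ' ∈ (Finset.univ : Finset (Equiv.Perm (Fin n))).image (fun σ : Equiv.Perm (Fin n) => ν ∘ ⇑σ),
        ((Nat.card 𝓀[F] : ℕ) : R) ^ (satakeTwistExp μ' - satakeTwistExp ν).toNat •
          AddMonoidAlgebra.single μ' (1 : R)).coeff μ = 0 := by
  rw [coeff_twistedOrbitSum, if_neg]
  rwa [mem_image_comp_perm_iff_eq_comp_sort hν]

/-- **The orbit sums satisfy the twisted orbit relation**: for `λ` monotone, `μ` monotone and `σ ∈ S_n`,
`(m_λ)_{μ∘σ} = q^{⟨ν, μ∘σ⟩ - ⟨ν, μ⟩} (m_λ)_μ`. [cite: ZhuIntegralSatake2020, §1.3 Lemma 8] -/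
theorem coeff_twistedOrbitSum_comp_perm {ν : Fin n → ℤ} (hν : Monotone ν) {μ : Fin n → ℤ} (hμ : Monotone μ)
    (σ : Equiv.Perm (Fin n)) :
    (∑ μ' ∈ (Finset.univ : Finset (Equiv.Perm (Fin n))).image (fun σ : Equiv.Perm (Fin n) => ν ∘ ⇑σ),
        ((Nat.card 𝓀[F] : ℕ) : R) ^ (satakeTwistExp μ' - satakeTwistExp ν).toNat •
          AddMonoidAlgebra.single μ' (1 : R)).coeff (μ ∘ σ) =
      ((Nat.card 𝓀[F] : ℕ) : R) ^ (satakeTwistExp (μ ∘ σ) - satakeTwistExp μ).toNat *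
        (∑ μ' ∈ (Finset.univ : Finset (Equiv.Perm (Fin n))).image (fun σ : Equiv.Perm (Fin n) => ν ∘ ⇑σ),
          ((Nat.card 𝓀[F] : ℕ) : R) ^ (satakeTwistExp μ' - satakeTwistExp ν).toNat •
            AddMonoidAlgebra.single μ' (1 : R)).coeff μ := by
  by_cases h : ν = μ
  · subst h
    rw [coeff_twistedOrbitSum_self, mul_one, coeff_twistedOrbitSum, if_pos (mem_image_comp_perm_iff.2 ⟨σ, rfl⟩)]
  · have h1 : ν ≠ μ ∘ Tuple.sort μ := by
      rwa [(Tuple.sort_eq_refl_iff_monotone).2 hμ, Equiv.coe_refl, Function.comp_id]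
    have h2 : ν ≠ (μ ∘ σ) ∘ Tuple.sort (μ ∘ σ) := by
      rwa [Tuple.comp_perm_comp_sort_eq_comp_sort, (Tuple.sort_eq_refl_iff_monotone).2 hμ, Equiv.coe_refl,
        Function.comp_id]
    rw [coeff_twistedOrbitSum_eq_zero hν h1, coeff_twistedOrbitSum_eq_zero hν h2, mul_zero]

/-- **EXPANSION IN ORBIT SUMS**: an element `f ∈ R[ℤⁿ]` satisfying the twisted orbit relation
`f_{μ∘σ} = q^{⟨ν, μ∘σ⟩ - ⟨ν, μ⟩} f_μ` (`μ` monotone) is the combination `f = ∑_λ f_λ m_λ` of the orbit sums over the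
antidominant representatives `λ` of its support. [cite: ZhuIntegralSatake2020, §1.3 Lemma 8] -/
theorem eq_sum_coeff_smul_twistedOrbitSum {f : AddMonoidAlgebra R (Fin n → ℤ)}
    (hf : ∀ μ : Fin n → ℤ, Monotone μ → ∀ σ : Equiv.Perm (Fin n),
      f.coeff (μ ∘ σ) = ((Nat.card 𝓀[F] : ℕ) : R) ^ (satakeTwistExp (μ ∘ σ) - satakeTwistExp μ).toNat * f.coeff μ) :
    f = ∑ ν ∈ f.coeff.support.image (fun μ : Fin n → ℤ => μ ∘ ⇑(Tuple.sort μ)),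
      f.coeff ν • ∑ μ' ∈ (Finset.univ : Finset (Equiv.Perm (Fin n))).image (fun σ : Equiv.Perm (Fin n) => ν ∘ ⇑σ),
        ((Nat.card 𝓀[F] : ℕ) : R) ^ (satakeTwistExp μ' - satakeTwistExp ν).toNat •
          AddMonoidAlgebra.single μ' (1 : R) := by
  classical
  refine AddMonoidAlgebra.ext (Finsupp.ext fun μ => ?_)
  rw [AddMonoidAlgebra.coeff_sum, Finsupp.finsetSum_apply]
  simp only [AddMonoidAlgebra.coeff_smul, Finsupp.smul_apply, smul_eq_mul]
  -- only the antidominant representative `μ₀ = μ ∘ sort μ` of `μ` contributes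
  have hvan : ∀ ν ∈ f.coeff.support.image (fun μ : Fin n → ℤ => μ ∘ ⇑(Tuple.sort μ)), ν ≠ μ ∘ Tuple.sort μ →
      f.coeff ν * (∑ μ' ∈ (Finset.univ : Finset (Equiv.Perm (Fin n))).image (fun σ : Equiv.Perm (Fin n) => ν ∘ ⇑σ),
        ((Nat.card 𝓀[F] : ℕ) : R) ^ (satakeTwistExp μ' - satakeTwistExp ν).toNat •
          AddMonoidAlgebra.single μ' (1 : R)).coeff μ = 0 := by
    intro ν hν hne
    obtain ⟨μ₁, -, rfl⟩ := Finset.mem_image.1 hν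
    rw [coeff_twistedOrbitSum_eq_zero (monotone_comp_sort μ₁) hne, mul_zero]
  have hrel : f.coeff μ = ((Nat.card 𝓀[F] : ℕ) : R) ^ (satakeTwistExp μ - satakeTwistExp (μ ∘ Tuple.sort μ)).toNat *
      f.coeff (μ ∘ Tuple.sort μ) := by
    have h := hf (μ ∘ Tuple.sort μ) (monotone_comp_sort μ) (Tuple.sort μ).symm
    rwa [comp_sort_comp_symm] at h
  by_cases hmem : μ ∘ Tuple.sort μ ∈ f.coeff.support.image (fun μ : Fin n → ℤ => μ ∘ ⇑(Tuple.sort μ))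
  · rw [Finset.sum_eq_single_of_mem _ hmem fun ν hν hne => hvan ν hν hne, coeff_twistedOrbitSum,
      if_pos (mem_image_comp_perm_iff.2 ⟨(Tuple.sort μ).symm, comp_sort_comp_symm μ⟩), hrel, mul_comm]
  · rw [Finset.sum_eq_zero fun ν hν => hvan ν hν (fun h => hmem (h ▸ hν))]
    have h0 : f.coeff (μ ∘ Tuple.sort μ) = 0 := by
      by_contra hne
      exact hmem (Finset.mem_image.2 ⟨μ ∘ Tuple.sort μ, Finsupp.mem_support_iff.2 hne, by
        rw [(Tuple.sort_eq_refl_iff_monotone).2 (monotone_comp_sort μ), Equiv.coe_refl, Function.comp_id]⟩)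
    rw [hrel, h0, mul_zero]

/-- **Zhu's Lemma 8, independence half**: the orbit sums `m_λ`, `λ` antidominant, are linearly independent over any `R`
(distinct antidominant `λ` have disjoint orbits and `m_λ` has coefficient `1` at `x^λ`). [cite: ZhuIntegralSatake2020, §1.3 Lemma 8] -/
theorem linearIndependent_twistedOrbitSum :
    LinearIndependent R (fun a : {a : Fin n → ℤ // Monotone a} =>
      ∑ μ' ∈ (Finset.univ : Finset (Equiv.Perm (Fin n))).image (fun σ : Equiv.Perm (Fin n) => (a : Fin n → ℤ) ∘ ⇑σ),
        ((Nat.card 𝓀[F] : ℕ) : R) ^ (satakeTwistExp μ' - satakeTwistExp (a : Fin n → ℤ)).toNat •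
          AddMonoidAlgebra.single μ' (1 : R)) := by
  classical
  refine linearIndependent_iff'.2 fun s l hl b hb => ?_
  have h := congrArg (fun f : AddMonoidAlgebra R (Fin n → ℤ) => f.coeff (b : Fin n → ℤ)) hl
  rw [AddMonoidAlgebra.coeff_sum, Finsupp.finsetSum_apply] at h
  simp only [AddMonoidAlgebra.coeff_smul, Finsupp.smul_apply, smul_eq_mul, AddMonoidAlgebra.coeff_zero,
    Finsupp.coe_zero, Pi.zero_apply] at h
  rw [Finset.sum_eq_single_of_mem b hb] at h
  · rwa [coeff_twistedOrbitSum_self, mul_one] at h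
  · intro c _ hcb
    rw [coeff_twistedOrbitSum_eq_zero c.2, mul_zero]
    rw [(Tuple.sort_eq_refl_iff_monotone).2 b.2, Equiv.coe_refl, Function.comp_id]
    exact fun h => hcb (Subtype.ext h)

/-- The range of the family of orbit sums indexed by the antidominant vectors is the image of the antidominant set.
[cite: ZhuIntegralSatake2020, §1.3 Lemma 8] -/
theorem range_twistedOrbitSum_eq_image :
    Set.range (fun a : {a : Fin n → ℤ // Monotone a} =>
      ∑ μ' ∈ (Finset.univ : Finset (Equiv.Perm (Fin n))).image (fun σ : Equiv.Perm (Fin n) => (a : Fin n → ℤ) ∘ ⇑σ),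
        ((Nat.card 𝓀[F] : ℕ) : R) ^ (satakeTwistExp μ' - satakeTwistExp (a : Fin n → ℤ)).toNat •
          AddMonoidAlgebra.single μ' (1 : R)) =
      (fun a : Fin n → ℤ =>
        ∑ μ' ∈ (Finset.univ : Finset (Equiv.Perm (Fin n))).image (fun σ : Equiv.Perm (Fin n) => a ∘ ⇑σ),
          ((Nat.card 𝓀[F] : ℕ) : R) ^ (satakeTwistExp μ' - satakeTwistExp a).toNat •
            AddMonoidAlgebra.single μ' (1 : R)) '' {a : Fin n → ℤ | Monotone a} :=
  Set.ext fun _ => ⟨by rintro ⟨a, rfl⟩; exact ⟨a, a.2, rfl⟩, by rintro ⟨a, ha, rfl⟩; exact ⟨⟨a, ha⟩, rfl⟩⟩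

end OrbitSum

/-! ## §5 Every orbit sum `m_λ` (`λ` monotone) is a counting transform: unitriangular induction -/

section Isomorphism

variable {F : Type*} [Field F] [ValuativeRel F] {n : ℕ} [IsDiscreteValuationRing 𝒪[F]] [Finite 𝓀[F]] {ϖ : F}
  [IsHeckeTriple (⊤ : Submonoid (GL (Fin n) F)) (glInt n F) (glInt n F)] {R : Type*} [CommRing R]

/-- **`m_λ ∈ 𝒮_1(ℋ_R)` for every antidominant `λ`** (any commutative `R`).  Induction on the potential: `𝒮_1(c_λ)`
(`c_λ = T_{K ϖ^λ K}`) satisfies the twisted orbit relation (§3), has coefficient `1` at `x^λ` (Bruhat–Tits (4.4.4) (ii),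
g42-#1) and all its exponents dominance-above `λ` of total `|λ|` (g42-#2/#3); by §4 it expands as
`𝒮_1(c_λ) = m_λ + ∑_{ν ≠ λ} 𝒮_1(c_λ)_ν m_ν` over monotone `ν` strictly above `λ`, of the same total and — being monotone — with
last entry `≤ λ_n`, so of smaller potential defect `∑_{s ≤ n} ∑_{i < s} (ν_n - ν_i)`; these `m_ν` are transforms by induction.
[cite: ZhuIntegralSatake2020, §1.4 Prop. 9, proof] [cite: BruhatTits1972, Prop. (4.4.4) (ii)]
[cite: Macdonald1995, Ch. V (2.6)] -/
theorem twistedOrbitSum_mem_range_satakeTransform_one (hϖ : IsUniformizingElement ϖ) {a : Fin n → ℤ} (ha : Monotone a) :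
    (∑ μ' ∈ (Finset.univ : Finset (Equiv.Perm (Fin n))).image (fun σ : Equiv.Perm (Fin n) => a ∘ ⇑σ),
        ((Nat.card 𝓀[F] : ℕ) : R) ^ (satakeTwistExp μ' - satakeTwistExp a).toNat •
          AddMonoidAlgebra.single μ' (1 : R)) ∈
      ((isIwasawaExponent_gl hϖ).satakeTransform (1 : Multiplicative (Fin n → ℤ) →* R)).range := by
  classical
  -- the potential defect `D(ν) = ∑_{s ≤ n} ∑_{i < s} (L(ν) - ν_i)`, `L(ν)` the last entry
  set L : (Fin n → ℤ) → ℤ := fun ν => ∑ i : Fin n, if (i : ℕ) < n - 1 then 0 else ν i with hL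
  set D : (Fin n → ℤ) → ℤ := fun ν =>
    ∑ s ∈ Finset.range (n + 1), ∑ i : Fin n, if (i : ℕ) < s then L ν - ν i else 0 with hD
  -- (D1) the last entry dominates a monotone vector
  have hlast : ∀ ν : Fin n → ℤ, Monotone ν → ∀ i, ν i ≤ L ν := by
    intro ν hν i
    have hn : 0 < n := Fin.pos i
    have hLν : L ν = ν ⟨n - 1, by omega⟩ := by
      simp only [hL]
      rw [Finset.sum_eq_single ⟨n - 1, by omega⟩]
      · simp only [lt_irrefl, if_false]
      · intro j _ hj
        have : (j : ℕ) < n - 1 := by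
          have h1 := j.isLt
          have h2 : (j : ℕ) ≠ n - 1 := fun h => hj (Fin.ext h)
          omega
        rw [if_pos this]
      · intro h
        exact absurd (Finset.mem_univ _) h
    rw [hLν]
    exact hν (Fin.le_def.2 (by have := i.isLt; simp only; omega))
  -- (D2) `D ≥ 0` on monotone vectors
  have hDnonneg : ∀ ν : Fin n → ℤ, Monotone ν → 0 ≤ D ν := fun ν hν =>
    Finset.sum_nonneg fun s _ => Finset.sum_nonneg fun i _ => by
      split_ifs
      · exact sub_nonneg.2 (hlast ν hν i)
      · exact le_rfl
  -- (D3) total = head sum `HS_{n-1}` + last entry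
  have htotal : ∀ ν : Fin n → ℤ, ∑ i, ν i = (∑ i : Fin n, if (i : ℕ) < n - 1 then ν i else 0) + L ν := by
    intro ν
    simp only [hL]
    rw [← Finset.sum_add_distrib]
    exact Finset.sum_congr rfl fun i _ => by split_ifs <;> simp
  -- (D4) `D` splits as `∑_s ∑_{i<s} L - potential`
  have hDsplit : ∀ ν : Fin n → ℤ, D ν = (∑ s ∈ Finset.range (n + 1), ∑ i : Fin n, if (i : ℕ) < s then L ν else 0) -
      ∑ s ∈ Finset.range (n + 1), ∑ i : Fin n, if (i : ℕ) < s then ν i else 0 := by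
    intro ν
    simp only [hD]
    rw [← Finset.sum_sub_distrib]
    refine Finset.sum_congr rfl fun s _ => ?_
    rw [← Finset.sum_sub_distrib]
    exact Finset.sum_congr rfl fun i _ => by split_ifs <;> simp
  -- (D5) strict decrease along strict dominance among monotone vectors of the same total
  have hDlt : ∀ b ν : Fin n → ℤ, Monotone ν →
      (∀ t : ℕ, (∑ i : Fin n, if (i : ℕ) < t then b i else 0) ≤ ∑ i : Fin n, if (i : ℕ) < t then ν i else 0) →
      ∑ i, ν i = ∑ i, b i → ν ≠ b → D ν < D b := by
    intro b ν hν hle hsum hne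
    have hLle : L ν ≤ L b := by
      have h1 := htotal ν
      have h2 := htotal b
      have h3 := hle (n - 1)
      omega
    have hP := sum_range_sum_ite_lt_lt_of_forall_le_of_ne hle (Ne.symm hne)
    have hX : (∑ s ∈ Finset.range (n + 1), ∑ i : Fin n, if (i : ℕ) < s then L ν else 0) ≤
        ∑ s ∈ Finset.range (n + 1), ∑ i : Fin n, if (i : ℕ) < s then L b else 0 :=
      Finset.sum_le_sum fun s _ => Finset.sum_le_sum fun i _ => by
        split_ifs
        · exact hLle
        · exact le_rfl
    rw [hDsplit ν, hDsplit b]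
    omega
  -- induction on `D a`
  suffices key : ∀ (N : ℕ) (a : Fin n → ℤ), Monotone a → D a < N →
      (∑ μ' ∈ (Finset.univ : Finset (Equiv.Perm (Fin n))).image (fun σ : Equiv.Perm (Fin n) => a ∘ ⇑σ),
        ((Nat.card 𝓀[F] : ℕ) : R) ^ (satakeTwistExp μ' - satakeTwistExp a).toNat •
          AddMonoidAlgebra.single μ' (1 : R)) ∈
      ((isIwasawaExponent_gl hϖ).satakeTransform (1 : Multiplicative (Fin n → ℤ) →* R)).range from
    key ((D a).toNat + 1) a ha (by have := hDnonneg a ha; omega)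
  intro N
  induction N with
  | zero =>
    intro a ha hlt
    exact absurd hlt (by have := hDnonneg a ha; omega)
  | succ N ih =>
    intro a ha hlt
    set S := (isIwasawaExponent_gl hϖ).satakeTransform (1 : Multiplicative (Fin n → ℤ) →* R) with hS
    set g := S (heckeAlgebra.doubleCosetOperator (k := R) (glInt n F) (zpowDiagGL hϖ.ne_zero a)) with hg
    -- `g` satisfies the twisted orbit relation, hence expands in orbit sums
    have hexp := eq_sum_coeff_smul_twistedOrbitSum (F := F) (R := R) (f := g)
      (fun μ hμ σ => coeff_satakeTransform_one_comp_perm hϖ _ hμ σ)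
    -- trivial ring: everything is `0`
    rcases subsingleton_or_nontrivial R with hR | hR
    · have h0 : (∑ μ' ∈ (Finset.univ : Finset (Equiv.Perm (Fin n))).image (fun σ : Equiv.Perm (Fin n) => a ∘ ⇑σ),
          ((Nat.card 𝓀[F] : ℕ) : R) ^ (satakeTwistExp μ' - satakeTwistExp a).toNat •
            AddMonoidAlgebra.single μ' (1 : R)) = 0 :=
        AddMonoidAlgebra.ext (Finsupp.ext fun _ => Subsingleton.elim _ _)
      rw [h0]
      exact Subalgebra.zero_mem _
    -- the leading coefficient: `g_a = 1`, so `a` is among the antidominant representatives of the support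
    have hga : g.coeff a = 1 := coeff_satakeTransform_one_doubleCosetOperator_zpowDiagGL_monotone hϖ ha
    have hamem : a ∈ g.coeff.support.image (fun μ : Fin n → ℤ => μ ∘ ⇑(Tuple.sort μ)) :=
      Finset.mem_image.2 ⟨a, Finsupp.mem_support_iff.2 (by rw [hga]; exact one_ne_zero), by
        rw [(Tuple.sort_eq_refl_iff_monotone).2 ha, Equiv.coe_refl, Function.comp_id]⟩
    -- split off the term `ν = a`
    rw [← Finset.add_sum_erase _ _ hamem, hga, one_smul] at hexp
    -- the remaining `m_ν` are transforms by induction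
    have hrest : (∑ ν ∈ (g.coeff.support.image (fun μ : Fin n → ℤ => μ ∘ ⇑(Tuple.sort μ))).erase a,
        g.coeff ν • ∑ μ' ∈ (Finset.univ : Finset (Equiv.Perm (Fin n))).image (fun σ : Equiv.Perm (Fin n) => ν ∘ ⇑σ),
          ((Nat.card 𝓀[F] : ℕ) : R) ^ (satakeTwistExp μ' - satakeTwistExp ν).toNat •
            AddMonoidAlgebra.single μ' (1 : R)) ∈ S.range := by
      refine Subalgebra.sum_mem _ fun ν hν => Subalgebra.smul_mem _ ?_ _
      obtain ⟨hνa, hν⟩ := Finset.mem_erase.1 hν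
      obtain ⟨μ₁, hμ₁, rfl⟩ := Finset.mem_image.1 hν
      have hνmono : Monotone (μ₁ ∘ Tuple.sort μ₁) := monotone_comp_sort μ₁
      have hνne : g.coeff (μ₁ ∘ Tuple.sort μ₁) ≠ 0 :=
        coeff_satakeTransform_one_comp_sort_ne_zero hϖ _ (Finsupp.mem_support_iff.1 hμ₁)
      refine ih _ hνmono (lt_of_lt_of_le (hDlt a _ hνmono
        (fun t => forall_sum_ite_lt_le_of_coeff_satakeTransform_zpowDiagGL_ne_zero hϖ 1 ha hνne t)
        (sum_eq_sum_of_coeff_satakeTransform_zpowDiagGL_ne_zero hϖ 1 a hνne) hνa) (by omega))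
    have hgmem : g ∈ S.range := ⟨_, rfl⟩
    rw [eq_sub_of_add_eq hexp.symm]
    exact Subalgebra.sub_mem _ hgmem hrest

/-! ## §6 The integral Satake isomorphism: the image of `𝒮_1` over any commutative ring `R` -/

/-- **THE INTEGRAL SATAKE ISOMORPHISM FOR `GL_n` (X. Zhu, Prop. 9 with Lemma 8; any commutative coefficient ring `R`, any
field `F` with a `ValuativeRel` whose valuation ring is a DVR with finite residue field of cardinality `q`).**  The counting
transform `𝒮_1 = CT^{cl} : ℋ_R(GL_n(F), GL_n(𝒪)) → R[ℤⁿ]`, `CT^{cl}(f) = ∑_λ (∑_{u ∈ U(F)/U(𝒪)} f(ϖ^λ u)) e^λ` — injective over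
every `R` (g42-#1) — has image EXACTLY the `R`-module of Laurent polynomials `f` whose coefficients along each `S_n`-orbit obey
`f_{μ∘σ} = q^{⟨ν, μ∘σ⟩ - ⟨ν, μ⟩} f_μ` for `μ` antidominant (monotone), `ν = (n-1, …, 1, 0)` (`⟨ν, μ∘σ - μ⟩ = ⟨ρ, μ∘σ - μ⟩ ≥ 0`):
«`CT^{cl} : H_G ≅ ℤ[X^•(T̂)] ∩ ℚ[X^•(T̂)]^{W_0 ∙_{ρ_ad}}`», `w ∙ e^μ = q^{⟨ρ_ad, wμ - μ⟩} e^{wμ}`.  For `q ∈ Rˣ` this is the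
`S_n`-invariance of the twisted transform `𝒮_R` (g42-#6); for `q = 0` in `R` it is Herzig's antidominant support (g42-#12).
[cite: ZhuIntegralSatake2020, §1.4 Prop. 9] [cite: TreumannVenkatesh2016, §7.2 Theorem] [cite: Herzig2010, Thm. 1.2] -/
theorem mem_range_satakeTransform_one_iff (hϖ : IsUniformizingElement ϖ) (f : AddMonoidAlgebra R (Fin n → ℤ)) :
    f ∈ ((isIwasawaExponent_gl hϖ).satakeTransform (1 : Multiplicative (Fin n → ℤ) →* R)).range ↔
      ∀ μ : Fin n → ℤ, Monotone μ → ∀ σ : Equiv.Perm (Fin n),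
        f.coeff (μ ∘ σ) = ((Nat.card 𝓀[F] : ℕ) : R) ^ (satakeTwistExp (μ ∘ σ) - satakeTwistExp μ).toNat * f.coeff μ := by
  constructor
  · rintro ⟨T, rfl⟩ μ hμ σ
    exact coeff_satakeTransform_one_comp_perm hϖ T hμ σ
  · intro hf
    rw [eq_sum_coeff_smul_twistedOrbitSum hf]
    refine Subalgebra.sum_mem _ fun ν hν => Subalgebra.smul_mem _ ?_ _
    obtain ⟨μ, -, rfl⟩ := Finset.mem_image.1 hν
    exact twistedOrbitSum_mem_range_satakeTransform_one hϖ (monotone_comp_sort μ)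

/-- **Zhu's Lemma 8, spanning half: `𝒮_1(ℋ_R) = span_R {m_λ : λ antidominant}`**, `m_λ = ∑_{μ ∈ S_n λ} q^{⟨ν, μ⟩ - ⟨ν, λ⟩} x^μ`
(«the subring … with a `ℤ`-basis given by elements of the form `∑_{λ' ∈ W_0 λ} q^{⟨ρ, λ' - λ⟩} e^{λ'}`, `λ ∈ X^•(T̂)^-`»).
[cite: ZhuIntegralSatake2020, §1.3 Lemma 8, §1.4 Prop. 9] -/
theorem range_satakeTransform_one_toSubmodule_eq_span (hϖ : IsUniformizingElement ϖ) :
    Subalgebra.toSubmodule ((isIwasawaExponent_gl hϖ).satakeTransform (1 : Multiplicative (Fin n → ℤ) →* R)).range =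
      Submodule.span R ((fun a : Fin n → ℤ =>
        ∑ μ' ∈ (Finset.univ : Finset (Equiv.Perm (Fin n))).image (fun σ : Equiv.Perm (Fin n) => a ∘ ⇑σ),
          ((Nat.card 𝓀[F] : ℕ) : R) ^ (satakeTwistExp μ' - satakeTwistExp a).toNat •
            AddMonoidAlgebra.single μ' (1 : R)) '' {a : Fin n → ℤ | Monotone a}) := by
  refine le_antisymm ?_ (Submodule.span_le.2 ?_)
  · intro f hf
    rw [Subalgebra.mem_toSubmodule, AlgHom.mem_range] at hf
    obtain ⟨T, rfl⟩ := hf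
    rw [eq_sum_coeff_smul_twistedOrbitSum (fun μ hμ σ => coeff_satakeTransform_one_comp_perm hϖ T hμ σ)]
    refine Submodule.sum_mem _ fun ν hν => Submodule.smul_mem _ _ (Submodule.subset_span ?_)
    obtain ⟨μ, -, rfl⟩ := Finset.mem_image.1 hν
    exact ⟨μ ∘ Tuple.sort μ, monotone_comp_sort μ, rfl⟩
  · rintro _ ⟨a, ha, rfl⟩
    exact twistedOrbitSum_mem_range_satakeTransform_one hϖ ha

/-- **`𝒮_1(ℋ_R)` IS FREE ON THE ORBIT SUMS `m_λ`, `λ` ANTIDOMINANT** (Zhu's Lemma 8: «a `ℤ`-basis given by elements of the form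
`∑_{λ' ∈ W_0 λ} q^{⟨ρ, λ' - λ⟩} e^{λ'}`», here over any commutative `R`; stated for the underlying `R`-submodule of the image
subalgebra). [cite: ZhuIntegralSatake2020, §1.3 Lemma 8, §1.4 Prop. 9] -/
theorem exists_basis_range_satakeTransform_one (hϖ : IsUniformizingElement ϖ) :
    ∃ b : Module.Basis {a : Fin n → ℤ // Monotone a} R
        (Subalgebra.toSubmodule ((isIwasawaExponent_gl hϖ).satakeTransform (1 : Multiplicative (Fin n → ℤ) →* R)).range),
      ∀ a, ((b a : Subalgebra.toSubmodule
          ((isIwasawaExponent_gl hϖ).satakeTransform (1 : Multiplicative (Fin n → ℤ) →* R)).range) :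
            AddMonoidAlgebra R (Fin n → ℤ)) =
        ∑ μ' ∈ (Finset.univ : Finset (Equiv.Perm (Fin n))).image (fun σ : Equiv.Perm (Fin n) => (a : Fin n → ℤ) ∘ ⇑σ),
          ((Nat.card 𝓀[F] : ℕ) : R) ^ (satakeTwistExp μ' - satakeTwistExp (a : Fin n → ℤ)).toNat •
            AddMonoidAlgebra.single μ' (1 : R) := by
  classical
  have hli := linearIndependent_twistedOrbitSum (F := F) (n := n) (R := R)
  have heq : Submodule.span R (Set.range (fun a : {a : Fin n → ℤ // Monotone a} =>
      ∑ μ' ∈ (Finset.univ : Finset (Equiv.Perm (Fin n))).image (fun σ : Equiv.Perm (Fin n) => (a : Fin n → ℤ) ∘ ⇑σ),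
        ((Nat.card 𝓀[F] : ℕ) : R) ^ (satakeTwistExp μ' - satakeTwistExp (a : Fin n → ℤ)).toNat •
          AddMonoidAlgebra.single μ' (1 : R))) =
      Subalgebra.toSubmodule ((isIwasawaExponent_gl hϖ).satakeTransform (1 : Multiplicative (Fin n → ℤ) →* R)).range := by
    rw [range_twistedOrbitSum_eq_image, range_satakeTransform_one_toSubmodule_eq_span hϖ]
  refine ⟨(Module.Basis.span hli).map (LinearEquiv.ofEq _ _ heq), fun a => ?_⟩
  rw [Module.Basis.map_apply, LinearEquiv.coe_ofEq_apply, Module.Basis.span_apply]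

/-- **`ℋ_R(GL_n(F), GL_n(𝒪))` IS FREE OVER `R` ON A BASIS INDEXED BY THE ANTIDOMINANT COWEIGHTS, TRANSPORTED THROUGH `𝒮_1`**:
the basis `𝒮_1⁻¹(m_λ)`, `λ` monotone (`𝒮_1` is injective over every `R`, g42-#1) — «in particular `H_G` is finitely generated»
sharpened to free of the expected rank; the tree's `free_heckeAlgebra_glInt` obtains freeness from the Cartan basis `c_λ` instead.
[cite: ZhuIntegralSatake2020, §1.4 Prop. 9] [cite: BruhatTits1972, Prop. (4.4.4) (ii)] -/
theorem exists_basis_heckeAlgebra_satakeTransform_eq_twistedOrbitSum (hϖ : IsUniformizingElement ϖ) :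
    ∃ b : Module.Basis {a : Fin n → ℤ // Monotone a} R (heckeAlgebra R (GL (Fin n) F) (glInt n F)),
      ∀ a, (isIwasawaExponent_gl hϖ).satakeTransform (1 : Multiplicative (Fin n → ℤ) →* R) (b a) =
        ∑ μ' ∈ (Finset.univ : Finset (Equiv.Perm (Fin n))).image (fun σ : Equiv.Perm (Fin n) => (a : Fin n → ℤ) ∘ ⇑σ),
          ((Nat.card 𝓀[F] : ℕ) : R) ^ (satakeTwistExp μ' - satakeTwistExp (a : Fin n → ℤ)).toNat •
            AddMonoidAlgebra.single μ' (1 : R) := by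
  classical
  obtain ⟨b, hb⟩ := exists_basis_range_satakeTransform_one (n := n) (R := R) hϖ
  -- `𝒮_1` co-restricted to its image is a linear equivalence onto the image submodule
  let e : heckeAlgebra R (GL (Fin n) F) (glInt n F) ≃ₗ[R] Subalgebra.toSubmodule
      ((isIwasawaExponent_gl hϖ).satakeTransform (1 : Multiplicative (Fin n → ℤ) →* R)).range :=
    LinearEquiv.ofBijective
      (((isIwasawaExponent_gl hϖ).satakeTransform (1 : Multiplicative (Fin n → ℤ) →* R)).toLinearMap.codRestrict
        (Subalgebra.toSubmodule ((isIwasawaExponent_gl hϖ).satakeTransform (1 : Multiplicative (Fin n → ℤ) →* R)).range)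
        fun T => ⟨T, rfl⟩)
      ⟨fun T₁ T₂ h => satakeTransform_gl_injective_of_commRing hϖ 1 (congrArg Subtype.val h),
        fun ⟨f, T, hT⟩ => ⟨T, Subtype.ext hT⟩⟩
  refine ⟨b.map e.symm, fun a => ?_⟩
  have h1 : (isIwasawaExponent_gl hϖ).satakeTransform (1 : Multiplicative (Fin n → ℤ) →* R) (e.symm (b a)) =
      ((e (e.symm (b a)) : Subalgebra.toSubmodule
        ((isIwasawaExponent_gl hϖ).satakeTransform (1 : Multiplicative (Fin n → ℤ) →* R)).range) :
          AddMonoidAlgebra R (Fin n → ℤ)) := rfl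
  rw [Module.Basis.map_apply, h1, LinearEquiv.apply_symm_apply, hb]

end Isomorphism

end Literature.NumberTheory.Automorphic

end
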